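import Mathlib
import HarnessLib
import Summits.CriticalPhenomena.Ising3DConformalLimit.Theses.FKParityRobustness

/-!
# Crux-ideate sketches for `FKFourConnectivity` (item stmt-CriticalPhenomena-11254), ideator 1, round 1

First lemmas of the two idea cards `cluster-hole-opacity` and `strict-fkg-quantitative`,
stated over existing declarations. Nothing here is proved (sorries mark the statements a
crux-plan skeleton would register); the point is that every transfer target elaborates and
concludes the crux BY NAME.
-/

namespace Summit.CriticalPhenomena.Ising3DConformalLimit.Cruxes.FKFourConnectivity.Ideator1

open scoped BigOperators Classical
open MeasureTheory Literature.Probability.LatticeModels Literature.Probability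

/-- The tetrahedral shape of the route (even corners of the cube `[-1,1]³`). -/
def tetra : Fin 4 → Site 3 := ![![-1, -1, -1], ![1, 1, -1], ![1, -1, 1], ![-1, 1, 1]]

/-- Card `cluster-hole-opacity`, transfer target HOLE.  Peel the cluster `C = C_ω(a₀)` on the
split event `S = {a₁ ∈ C, a₂ ∉ C, a₃ ∉ C}`; by the free domain Markov property the rest of the
configuration is the FK measure conditioned on `D_C = {every edge touching C is closed}`, i.e.
the FK-Ising measure of the holed graph `Λ_N ∖ C`, and `φ[a₂ ↔ a₃ | D_C] = ⟨σ_{a₂}σ_{a₃}⟩^free_{Λ_N∖C}`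
(Edwards–Sokal on the subgraph).  HOLE: the *hole opacity*
`δ(C) = 1 - φ[a₂↔a₃ | D_C] / φ[a₂↔a₃]` of the peeled cluster has expectation `≥ c·φ[a₀↔a₁]` on `S`. -/
def HoleOpacity : Prop :=
  ∃ c : ℝ, 0 < c ∧ ∀ l : ℕ, 1 ≤ l → ∃ N₀ : ℕ, ∀ N : ℕ, N₀ ≤ N → ∀ a : Fin 4 → ↥(box 3 N),
    (∀ i, ((a i : Site 3)) = (l : ℤ) • tetra i) →
    (let G := ((zdGraph 3).comap (Subtype.val : ↥(box 3 N) → Site 3))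
     let φ := rcMeasure G (fkIsingParam (criticalBeta 3)) 2 ∅
     let C : Set (Sym2 ↥(box 3 N)) → Set ↥(box 3 N) := fun ω => {v | (Percolation.openGraph ω).Reachable (a 0) v}
     let D : Set ↥(box 3 N) → Set (Set (Sym2 ↥(box 3 N))) := fun K => {ω | ∀ e ∈ ω, ∀ v ∈ K, v ∉ e}
     let S : Set (Set (Sym2 ↥(box 3 N))) := {ω | (Percolation.openGraph ω).Reachable (a 0) (a 1) ∧
        ¬ (Percolation.openGraph ω).Reachable (a 0) (a 2) ∧ ¬ (Percolation.openGraph ω).Reachable (a 0) (a 3)}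
     let δ : Set (Sym2 ↥(box 3 N)) → ℝ := fun ω =>
        1 - φ.real (Percolation.openConn (a 2) (a 3) ∩ D (C ω)) / (φ.real (D (C ω)) * φ.real (Percolation.openConn (a 2) (a 3)))
     c * φ.real (Percolation.openConn (a 0) (a 1)) ≤ ∫ ω, S.indicator δ ω ∂φ)

/-- First lemma of `cluster-hole-opacity` (provable now: domain Markov peel identity
`s = ⟨σ₂σ₃⟩-weighted expectation of 1 - δ`, FKG `φ[01 ∧ 23] ≥ φ[01]φ[23]`, and
`P4 ≥ φ[01]φ[23] - s`).  HOLE concludes the crux by name. -/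
theorem fkFourConnectivity_of_holeOpacity :
    HoleOpacity → Theses.FKParityRobustness.FKFourConnectivity := by
  sorry

/-- Card `strict-fkg-quantitative`, transfer target STRICT-FKG: a scale-uniform *gain* in the FKG
inequality for the two pair-connection events of the tetrahedron. -/
def StrictFKG : Prop :=
  ∃ c : ℝ, 0 < c ∧ ∀ l : ℕ, 1 ≤ l → ∃ N₀ : ℕ, ∀ N : ℕ, N₀ ≤ N → ∀ a : Fin 4 → ↥(box 3 N),
    (∀ i, ((a i : Site 3)) = (l : ℤ) • tetra i) →
    (let G := ((zdGraph 3).comap (Subtype.val : ↥(box 3 N) → Site 3))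
     let φ := rcMeasure G (fkIsingParam (criticalBeta 3)) 2 ∅
     (1 + c) * (φ.real (Percolation.openConn (a 0) (a 1)) * φ.real (Percolation.openConn (a 2) (a 3))) ≤
       φ.real (Percolation.openConn (a 0) (a 1) ∩ Percolation.openConn (a 2) (a 3)))

/-- The exact finite-volume inequality behind the card (provable now from Lebowitz `U₄ ≤ 0`,
Edwards–Sokal `⟨σ_A⟩ = φ[F_A]`, the `S₄`-symmetry of `(Λ_N, A_l)` making the three pair-split
events equiprobable, and FKG): `P4 ≥ (3/2)·Cov_φ(1{a₀↔a₁}, 1{a₂↔a₃})` at every `l, N`. -/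
def ThreeHalvesCovBound : Prop :=
  ∀ (l N : ℕ) (a : Fin 4 → ↥(box 3 N)), 1 ≤ l → (∀ i, ((a i : Site 3)) = (l : ℤ) • tetra i) →
    (let G := ((zdGraph 3).comap (Subtype.val : ↥(box 3 N) → Site 3))
     let φ := rcMeasure G (fkIsingParam (criticalBeta 3)) 2 ∅
     (3 / 2 : ℝ) * (φ.real (Percolation.openConn (a 0) (a 1) ∩ Percolation.openConn (a 2) (a 3)) -
        φ.real (Percolation.openConn (a 0) (a 1)) * φ.real (Percolation.openConn (a 2) (a 3))) ≤
       φ.real {ω | ∀ i j, (Percolation.openGraph ω).Reachable (a i) (a j)})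

/-- First lemma of `strict-fkg-quantitative`: STRICT-FKG concludes the crux by name (via
`ThreeHalvesCovBound`: `P4 ≥ (3/2)·c·φ[01]φ[23]`). -/
theorem fkFourConnectivity_of_strictFKG :
    ThreeHalvesCovBound → StrictFKG → Theses.FKParityRobustness.FKFourConnectivity := by
  sorry

/-! ### The engine of `strict-fkg-quantitative`: quantitative FKG transferred to the FK measure -/

section Transfer

variable {V : Type} [Fintype V] [DecidableEq V]

/-- Probability that the edge `e` is pivotal for the event `A` (open or closed pivotal). -/
noncomputable def pivProb (μ : Measure (Set (Sym2 V))) (A : Set (Set (Sym2 V))) (e : Sym2 V) : ℝ :=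
  μ.real {ω | ¬ (insert e ω ∈ A ↔ ω \ {e} ∈ A)}

/-- Talagrand's weight function `φ_T(x) = x / log(e/x)`. -/
noncomputable def talagrandPhi (x : ℝ) : ℝ := x / Real.log (Real.exp 1 / x)

end Transfer

/-- LEVEL-ONE INEQUALITY FOR FK (candidate lemma, dimension-free, provable from Parseval in
Gaussian space through the sequential monotone coupling; checked exactly on small graphs):
`Σ_e φ[e pivotal for A]² ≤ C(p,q)·Var_φ(1_A)` for every increasing event `A`. -/
def LevelOneFK : Prop :=
  ∀ p q : ℝ, 0 < p → p < 1 → 1 ≤ q → ∃ C : ℝ, ∀ (V : Type) [Fintype V] [DecidableEq V]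
    (G : SimpleGraph V) [DecidableRel G.Adj] (A : Set (Set (Sym2 V))), IsUpperSet A →
    (let φ := rcMeasure G p q ∅
     ∑ e ∈ G.edgeFinset, pivProb φ A e ^ 2 ≤ C * (φ.real A * (1 - φ.real A)))

/-- TRANSFERRED TALAGRAND INEQUALITY (candidate lemma: Keller–Mossel–Sen 2014, Thm 1.6, in
Gaussian space, pulled back along the sequential monotone coupling of the monotonic measure
`φ_{p,q}`, `q ≥ 1`, whose single-edge thresholds lie in `[p/(p+q(1-p)), p]`):
`Cov_φ(1_A,1_B) ≥ c·φ_T(κ Σ_e φ[e piv A] φ[e piv B])` for increasing `A, B`. -/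
def FKTalagrand : Prop :=
  ∀ p q : ℝ, 0 < p → p < 1 → 1 ≤ q → ∃ κ c : ℝ, 0 < κ ∧ κ ≤ 1 ∧ 0 < c ∧
    ∀ (V : Type) [Fintype V] [DecidableEq V] (G : SimpleGraph V) [DecidableRel G.Adj]
      (A B : Set (Set (Sym2 V))), IsUpperSet A → IsUpperSet B →
    (let φ := rcMeasure G p q ∅
     c * talagrandPhi (κ * ∑ e ∈ G.edgeFinset, pivProb φ A e * pivProb φ B e) ≤
       φ.real (A ∩ B) - φ.real A * φ.real B)

/-- SHARED-PIVOTAL SATURATION (the open, `d = 3`-specific bet of the card, pure-pivotal form):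
the two pair-connections of the tetrahedron share pivotal locations at the Talagrand–Lebowitz
ceiling, `Σ_e φ[e piv 01]·φ[e piv 23] ≥ K·φ[01]φ[23]·log l`. -/
def SharedPivotalSaturation : Prop :=
  ∃ K : ℝ, 0 < K ∧ ∀ l : ℕ, 2 ≤ l → ∃ N₀ : ℕ, ∀ N : ℕ, N₀ ≤ N → ∀ a : Fin 4 → ↥(box 3 N),
    (∀ i, ((a i : Site 3)) = (l : ℤ) • tetra i) →
    (let G := ((zdGraph 3).comap (Subtype.val : ↥(box 3 N) → Site 3))
     let φ := rcMeasure G (fkIsingParam (criticalBeta 3)) 2 ∅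
     K * (φ.real (Percolation.openConn (a 0) (a 1)) * φ.real (Percolation.openConn (a 2) (a 3))) * Real.log l ≤
       ∑ e ∈ G.edgeFinset, pivProb φ (Percolation.openConn (a 0) (a 1)) e * pivProb φ (Percolation.openConn (a 2) (a 3)) e)

/-- The card's composition: transferred Talagrand + saturation give STRICT-FKG (since
`φ_T(K G² log l) ≍ G²` when `G² ≍ l^{-2-2η}`, using the tree's `criticalTwoPoint_bounds_holds`
for `log(1/φ[01]) ≍ log l`), hence the crux. -/
theorem strictFKG_of_talagrand_saturation :
    FKTalagrand → SharedPivotalSaturation → StrictFKG := by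
  sorry

/-- PIVOTAL-OVERLAP CEILING (rigorous by-product, negative knowledge): Lebowitz' `Cov ≤ 3φ[01]φ[23]`
and `FKTalagrand` cap the shared pivotal mass at the marginal order `G² log l`. -/
def PivotalOverlapCeiling : Prop :=
  ∃ Cc : ℝ, ∀ l : ℕ, 2 ≤ l → ∃ N₀ : ℕ, ∀ N : ℕ, N₀ ≤ N → ∀ a : Fin 4 → ↥(box 3 N),
    (∀ i, ((a i : Site 3)) = (l : ℤ) • tetra i) →
    (let G := ((zdGraph 3).comap (Subtype.val : ↥(box 3 N) → Site 3))
     let φ := rcMeasure G (fkIsingParam (criticalBeta 3)) 2 ∅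
     ∑ e ∈ G.edgeFinset, pivProb φ (Percolation.openConn (a 0) (a 1)) e * pivProb φ (Percolation.openConn (a 2) (a 3)) e ≤
       Cc * (φ.real (Percolation.openConn (a 0) (a 1)) * φ.real (Percolation.openConn (a 2) (a 3))) * Real.log l)

theorem pivotalOverlapCeiling_of_talagrand : FKTalagrand → PivotalOverlapCeiling := by
  sorry

end Summit.CriticalPhenomena.Ising3DConformalLimit.Cruxes.FKFourConnectivity.Ideator1
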